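import Summits.QuantumFields.YangMills.Theorems.VirialFluxGapSharpTwistedLaplaceProof
import Summits.QuantumFields.YangMills.Theorems.VirialFluxGapTwistedEquipartitionGlue
import Summits.QuantumFields.YangMills.Theorems.VirialFluxGapConvexTransport
import Summits.QuantumFields.YangMills.Theorems.VirialFluxGapLogSectorWeightConvex
import HarnessLib

/-!
# ⟨stmt-QuantumFields-24142⟩ `VirialFluxGap.TwistedEquipartition` from its (now all proved) children

Width seat ym-line-sfw-p2-w3 g57 (cell ym-idea-1).  The planner's split of the crux `TwistedEquipartition` (route VirialFluxGap, LINE g14-A):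
✓`TwistedEquipartitionGlue` (24183) : `SharpTwistedLaplace → ConvexTransport → LogSectorWeightConvex → TwistedEquipartition`, with
✓`SharpTwistedLaplace` (24204, `FixSplit.sharpTwistedLaplace_holds`), ✓`ConvexTransport` (24181, `ConvexTransport.convexTransport_proof`),
✓`LogSectorWeightConvex` (24182, `virialFluxGap_logSectorWeightConvex_proof`).  Hence:
* ★ `twistedEquipartition_holds : Summit.QuantumFields.YangMills.Theses.VirialFluxGap.TwistedEquipartition`.
HONEST FRAMING: closes the RECORD-label crux 24142 of route VirialFluxGap (twisted equipartition of the femto-transfer sector weights on a deep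
window); the other leaf `PeriodicSoftness` and the route's assembly stay OPEN; ⟨22884⟩ OPEN; the Yang–Mills mass gap (Clay) is NOT proved; no summit
is proved by a line.

## References
* M. Lüscher, *Nucl. Phys. B* 219 (1983) 233–261, §2. [Luscher1983]
-/

set_option autoImplicit false

namespace Summit.QuantumFields.YangMills.Theorems.VirialFluxGap.FixSplit

/-- ★ **⟨stmt-QuantumFields-24142⟩ `TwistedEquipartition`** — glue ∘ (SharpTwistedLaplace, ConvexTransport, LogSectorWeightConvex).
[cite: Luscher1983, §2] -/
theorem twistedEquipartition_holds : Summit.QuantumFields.YangMills.Theses.VirialFluxGap.TwistedEquipartition :=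
  Summit.QuantumFields.YangMills.Theorems.VirialFluxGap.TwistedEquipartitionGlue.twistedEquipartitionGlue_proof sharpTwistedLaplace_holds
    Summit.QuantumFields.YangMills.Theorems.VirialFluxGap.ConvexTransport.convexTransport_proof
    Summit.QuantumFields.YangMills.Theorems.virialFluxGap_logSectorWeightConvex_proof

end Summit.QuantumFields.YangMills.Theorems.VirialFluxGap.FixSplit
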